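import Summits.Ventures.WeilGRH.FlatWindowCrossWindow
import Summits.Ventures.WeilGRH.ZetaFlatWindowSpectral
import Summits.RiemannHypothesis.RiemannHypothesis.Theorems.WeilBochnerRepresentationRungs
import HarnessLib

/-!
# rh-explicit (venture WeilGRH): the `ζ` flat-window DEFECT — atom-removed identity, mean defect, cross-window
  law, and PRIME-FREE SUM RULES (unconditional for the proved rungs)

Cell `rh-explicit`, WEIL TRACK (structure seat weil-3, gen9).  The `ζ` twins of `FlatWindowMeanDefect`
and `FlatWindowCrossWindow` (whose measure-level theorems are character-free), on top of
`ZetaFlatWindowSpectral.zetaFlatWindow_eq_pole_sub_integral`: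

* **`zetaFlatWindow_defect_eq`** (RH-free, any `ζ`-window measure on `[-a,a]`):
  `D(a) := 16 sinh²(a/2)/a − K₀ + I₀(a)/a − 2S(a) − 2a·μ{0} = ∫ 2sin²(at)/(at²) dμ`;
* **`zeta_defect_primeFree_eq`**: for `0 < b ≤ (log 2)/2` (no prime power below `e^{2b}`) and EVERY
  positive `μ` representing Weil's form on `[-b, b]` — such `μ` EXIST unconditionally
  (`WeilBochnerRungs.exists_measure_of_le_8046`) —
  `∫ 2sin²(bt)/(bt²) dμ + 2b·μ{0} = 16 sinh²(b/2)/b − K₀ + I₀(b)/b` (explicit: no primes, no zeros);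
  `exists_measure_and_defect_primeFree_eq`: the unconditional existence-plus-identity statement;
* **`zeta_sumRule_of_riemannHypothesis`**: under RH, for `0 < b ≤ (log 2)/2`,
  `∫ 2sin²(bt)/(bt²) dν_ζ = 16 sinh²(b/2)/b − K₀ + I₀(b)/b`, i.e. `Σ_ρ 2sin²(bγ)/γ² = 16sinh²(b/2) − bK₀ + I₀(b)`
  (numerically `0.053 / 0.054 / 0.041 / 0.047 / 0.064` at `b = 0.05 / 0.1 / 0.2 / 0.3 / 0.3465`);
* **`tendsto_average_defect_zeta`**, **`zeta_sq_sub_defect_le`**: for a measure representing Weil's form on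
  ALL tests (under RH: `ν_ζ`), the mean defect `(1/A)∫₀^A a·D(a)da → ∫t⁻²dμ` and the cross-window law
  `(a₁D(a₁) − a₂D(a₂))² ≤ (a₁+a₂)D(a₁+a₂)·(a₁−a₂)D(a₁−a₂)`.

No definitions, no named facts; RH only where named.
-/

set_option autoImplicit false

noncomputable section

open Complex Filter Set MeasureTheory
open scoped Real Topology ComplexConjugate ArithmeticFunction.vonMangoldt

namespace Summit.Ventures.WeilGRH

open Literature.NumberTheory.LFunctions
open Literature.NumberTheory.LFunctions.Yoshida1992 (chi)
open Literature.NumberTheory.LFunctions.WeilBochner (zetaZeroHeightMeasure)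
open Summit.RiemannHypothesis.RiemannHypothesis.Theorems.WeilBochnerMeasure (integrable_inv_one_add_sq)

variable {a : ℝ}

/-- **The `ζ` defect, atom removed** (RH-free): for `a > 0` and every positive `μ` representing Weil's form
on the tests of `[-a, a]`: `16 sinh²(a/2)/a − K₀ + I₀(a)/a − 2S(a) − 2a·μ{0} = ∫ 2sin²(at)/(at²) dμ`. -/
theorem zetaFlatWindow_defect_eq (ha : 0 < a) {μ : Measure ℝ}
    (hμ : ∀ g : ℝ → ℂ, IsWeilTest g → tsupport g ⊆ Icc (-a) a →
      Integrable (fun t : ℝ ↦ ‖weilMellin g (1 / 2 + t * I)‖ ^ 2) μ ∧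
        weilQuadratic g = ((∫ t, ‖weilMellin g (1 / 2 + t * I)‖ ^ 2 ∂μ : ℝ) : ℂ)) :
    Integrable (fun t : ℝ ↦ 2 * Real.sin (a * t) ^ 2 / (a * t ^ 2)) μ ∧
      16 * Real.sinh (a / 2) ^ 2 / a -
          (Real.log (4 * π) + Real.eulerMascheroniConstant +
            2 * ∫ t in Ioi (0 : ℝ), weilKillingDensityPar 0 t) +
          1 / a * (∫ t in Ioi (0 : ℝ), weilArchDensityPar 0 t * min t (2 * a)) -
          2 * (∑ n ∈ weilPrimeIndex a, (Λ n : ℝ) / Real.sqrt n * (1 - Real.log n / (2 * a))) -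
          2 * a * μ.real {0} =
        ∫ t, 2 * Real.sin (a * t) ^ 2 / (a * t ^ 2) ∂μ := by
  obtain ⟨hint, heq⟩ := zetaFlatWindow_eq_pole_sub_integral ha hμ
  have hI := integrable_inv_one_add_sq ha hμ
  have h0 := measure_zero_lt_top_of_integrable hI
  have hind : Integrable (fun t : ℝ ↦ ({0} : Set ℝ).indicator (fun _ ↦ 2 * a) t) μ :=
    (integrable_indicator_iff (measurableSet_singleton 0)).2 (integrableOn_const h0.ne)
  have hdecomp : (fun t : ℝ ↦ ‖weilMellin (chi a 0) (1 / 2 + t * I)‖ ^ 2) =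
      fun t ↦ ({0} : Set ℝ).indicator (fun _ ↦ 2 * a) t + 2 * Real.sin (a * t) ^ 2 / (a * t ^ 2) :=
    funext (norm_sq_weilMellin_chi_zero_eq_indicator_add ha)
  have hF : Integrable (fun t : ℝ ↦ 2 * Real.sin (a * t) ^ 2 / (a * t ^ 2)) μ := by
    refine (hint.sub hind).congr (Eventually.of_forall fun t ↦ ?_)
    show ‖weilMellin (chi a 0) (1 / 2 + t * I)‖ ^ 2 - ({0} : Set ℝ).indicator (fun _ ↦ 2 * a) t = _
    rw [norm_sq_weilMellin_chi_zero_eq_indicator_add ha]; ring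
  refine ⟨hF, ?_⟩
  rw [hdecomp, integral_add hind hF, integral_indicator_const _ (measurableSet_singleton 0), smul_eq_mul] at heq
  linarith

/-! ## Prime-free windows: explicit identities, unconditional for the proved rungs -/

/-- Below the first prime the `ζ` flat sum is empty (`2b ≤ log 2`). -/
theorem zetaFlatSum_eq_zero_of_two_mul_le_log_two {b : ℝ} (hb : 2 * b ≤ Real.log 2) :
    ∑ n ∈ weilPrimeIndex b, (Λ n : ℝ) / Real.sqrt n * (1 - Real.log n / (2 * b)) = 0 := by
  refine Finset.sum_eq_zero fun n hn ↦ ?_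
  have hlog : Real.log n < 2 * b := mem_weilPrimeIndex.1 hn
  have hn2 : n < 2 := by
    by_contra h
    have h2 : (2 : ℝ) ≤ n := by exact_mod_cast not_lt.1 h
    have := Real.log_le_log two_pos h2
    linarith
  interval_cases n <;> simp

/-- **PRIME-FREE `ζ` IDENTITY** (RH-free): for `0 < b`, `2b ≤ log 2`, and every positive `μ` representing
Weil's form on the tests of `[-b, b]`:
`∫ 2sin²(bt)/(bt²) dμ + 2b·μ{0} = 16 sinh²(b/2)/b − K₀ + I₀(b)/b` — an explicit number. -/
theorem zeta_defect_primeFree_eq {b : ℝ} (hb : 0 < b) (hb2 : 2 * b ≤ Real.log 2) {μ : Measure ℝ}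
    (hμ : ∀ g : ℝ → ℂ, IsWeilTest g → tsupport g ⊆ Icc (-b) b →
      Integrable (fun t : ℝ ↦ ‖weilMellin g (1 / 2 + t * I)‖ ^ 2) μ ∧
        weilQuadratic g = ((∫ t, ‖weilMellin g (1 / 2 + t * I)‖ ^ 2 ∂μ : ℝ) : ℂ)) :
    (∫ t, 2 * Real.sin (b * t) ^ 2 / (b * t ^ 2) ∂μ) + 2 * b * μ.real {0} =
      16 * Real.sinh (b / 2) ^ 2 / b -
        (Real.log (4 * π) + Real.eulerMascheroniConstant + 2 * ∫ t in Ioi (0 : ℝ), weilKillingDensityPar 0 t) +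
        1 / b * ∫ t in Ioi (0 : ℝ), weilArchDensityPar 0 t * min t (2 * b) := by
  obtain ⟨-, heq⟩ := zetaFlatWindow_defect_eq hb hμ
  rw [zetaFlatSum_eq_zero_of_two_mul_le_log_two hb2] at heq
  linarith

/-- **Unconditionally**: for every `0 < b ≤ (log 2)/2` there IS a positive measure representing Weil's form on
`[-b, b]` (the rung is Yoshida's theorem, in the tree up to `4023/5000`), and every such measure satisfies
the prime-free identity. -/
theorem exists_measure_and_defect_primeFree_eq {b : ℝ} (hb : 0 < b) (hb2 : 2 * b ≤ Real.log 2) :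
    ∃ μ : Measure ℝ, (∀ g : ℝ → ℂ, IsWeilTest g → tsupport g ⊆ Icc (-b) b →
        Integrable (fun t : ℝ ↦ ‖weilMellin g (1 / 2 + t * I)‖ ^ 2) μ ∧
          weilQuadratic g = ((∫ t, ‖weilMellin g (1 / 2 + t * I)‖ ^ 2 ∂μ : ℝ) : ℂ)) ∧
      (∫ t, 2 * Real.sin (b * t) ^ 2 / (b * t ^ 2) ∂μ) + 2 * b * μ.real {0} =
        16 * Real.sinh (b / 2) ^ 2 / b -
          (Real.log (4 * π) + Real.eulerMascheroniConstant + 2 * ∫ t in Ioi (0 : ℝ), weilKillingDensityPar 0 t) +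
          1 / b * ∫ t in Ioi (0 : ℝ), weilArchDensityPar 0 t * min t (2 * b) := by
  have hlog2 : Real.log 2 < 1 := by
    have := Real.log_two_lt_d9; linarith
  have hb' : b ≤ 4023 / 5000 := by linarith
  obtain ⟨μ, -, hμ⟩ := Summit.RiemannHypothesis.RiemannHypothesis.Theorems.WeilBochnerRungs.exists_measure_of_le_8046 hb hb'
  exact ⟨μ, hμ, zeta_defect_primeFree_eq hb hb2 hμ⟩

/-- **SUM RULE FOR THE ZEROS OF `ζ` AT PRIME-FREE WINDOWS** (under RH): for `0 < b`, `2b ≤ log 2`,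
`∫ 2sin²(bt)/(bt²) dν_ζ = 16 sinh²(b/2)/b − K₀ + I₀(b)/b` (`ν_ζ` the zero heights with multiplicity; no atom at
the centre since `ζ(½) ≠ 0`), i.e. `Σ_ρ 2sin²(bγ)/γ² = 16 sinh²(b/2) − bK₀ + I₀(b)`. -/
theorem zeta_sumRule_of_riemannHypothesis (hRH : RiemannHypothesis) {b : ℝ} (hb : 0 < b)
    (hb2 : 2 * b ≤ Real.log 2) :
    ∫ t, 2 * Real.sin (b * t) ^ 2 / (b * t ^ 2) ∂zetaZeroHeightMeasure =
      16 * Real.sinh (b / 2) ^ 2 / b -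
        (Real.log (4 * π) + Real.eulerMascheroniConstant + 2 * ∫ t in Ioi (0 : ℝ), weilKillingDensityPar 0 t) +
        1 / b * ∫ t in Ioi (0 : ℝ), weilArchDensityPar 0 t * min t (2 * b) := by
  have h := zeta_defect_primeFree_eq hb hb2
    (fun g hg _ ↦ WeilBochner.weilQuadratic_eq_integral_of_riemannHypothesis hRH hg)
  have hm : zetaZeroHeightMeasure.real {0} = 0 := by
    rw [measureReal_def, zetaZeroHeightMeasure_singleton_zero_of_riemannHypothesis hRH, ENNReal.toReal_zero]
  rw [hm, mul_zero, add_zero] at h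
  exact h

/-! ## All windows: the mean defect and the cross-window law for `ζ` -/

/-- **The mean defect for `ζ`**: for every positive `μ` representing Weil's form on all tests (under RH: `ν_ζ`)
with `t⁻² ∈ L¹(μ)`: `(1/A)∫₀^A a·D(a) da → ∫ t⁻² dμ`, `D(a) = 16sinh²(a/2)/a − K₀ + I₀(a)/a − 2S(a) − 2a·μ{0}`. -/
theorem tendsto_average_defect_zeta {μ : Measure ℝ}
    (hμ : ∀ g : ℝ → ℂ, IsWeilTest g →
      Integrable (fun t : ℝ ↦ ‖weilMellin g (1 / 2 + t * I)‖ ^ 2) μ ∧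
        weilQuadratic g = ((∫ t, ‖weilMellin g (1 / 2 + t * I)‖ ^ 2 ∂μ : ℝ) : ℂ))
    (hM : Integrable (fun t : ℝ ↦ (t ^ 2)⁻¹) μ) :
    Tendsto (fun A : ℝ ↦ 1 / A * ∫ a in (0 : ℝ)..A,
        a * (16 * Real.sinh (a / 2) ^ 2 / a -
          (Real.log (4 * π) + Real.eulerMascheroniConstant +
            2 * ∫ t in Ioi (0 : ℝ), weilKillingDensityPar 0 t) +
          1 / a * (∫ t in Ioi (0 : ℝ), weilArchDensityPar 0 t * min t (2 * a)) -
          2 * (∑ n ∈ weilPrimeIndex a, (Λ n : ℝ) / Real.sqrt n * (1 - Real.log n / (2 * a))) -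
          2 * a * μ.real {0})) atTop
      (𝓝 (∫ t, (t ^ 2)⁻¹ ∂μ)) := by
  have hI : Integrable (fun t : ℝ ↦ (1 + t ^ 2)⁻¹) μ := integrable_inv_one_add_sq one_pos (fun g hg _ ↦ hμ g hg)
  haveI : SigmaFinite μ := sigmaFinite_of_integrable_inv_one_add_sq hI
  have hptw : ∀ a : ℝ, 0 ≤ a →
      a * (16 * Real.sinh (a / 2) ^ 2 / a -
          (Real.log (4 * π) + Real.eulerMascheroniConstant +
            2 * ∫ t in Ioi (0 : ℝ), weilKillingDensityPar 0 t) +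
          1 / a * (∫ t in Ioi (0 : ℝ), weilArchDensityPar 0 t * min t (2 * a)) -
          2 * (∑ n ∈ weilPrimeIndex a, (Λ n : ℝ) / Real.sqrt n * (1 - Real.log n / (2 * a))) -
          2 * a * μ.real {0}) = ∫ t, 2 * Real.sin (a * t) ^ 2 / t ^ 2 ∂μ := by
    intro a ha0
    rcases ha0.eq_or_lt with rfl | ha
    · simp
    · obtain ⟨hF, heq⟩ := zetaFlatWindow_defect_eq ha (fun g hg _ ↦ hμ g hg)
      rw [heq, ← integral_const_mul]
      refine integral_congr_ae (Eventually.of_forall fun t ↦ ?_)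
      show a * (2 * Real.sin (a * t) ^ 2 / (a * t ^ 2)) = 2 * Real.sin (a * t) ^ 2 / t ^ 2
      rcases eq_or_ne t 0 with rfl | ht
      · simp
      · field_simp
  have hev : ∀ᶠ A in atTop, ∫ t, (t ^ 2)⁻¹ * (1 - Real.sin (2 * A * t) / (2 * A * t)) ∂μ =
      1 / A * ∫ a in (0 : ℝ)..A,
        a * (16 * Real.sinh (a / 2) ^ 2 / a -
          (Real.log (4 * π) + Real.eulerMascheroniConstant +
            2 * ∫ t in Ioi (0 : ℝ), weilKillingDensityPar 0 t) +
          1 / a * (∫ t in Ioi (0 : ℝ), weilArchDensityPar 0 t * min t (2 * a)) -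
          2 * (∑ n ∈ weilPrimeIndex a, (Λ n : ℝ) / Real.sqrt n * (1 - Real.log n / (2 * a))) -
          2 * a * μ.real {0}) := by
    filter_upwards [eventually_gt_atTop (0 : ℝ)] with A hA
    rw [intervalIntegral.integral_congr (g := fun a ↦ ∫ t, 2 * Real.sin (a * t) ^ 2 / t ^ 2 ∂μ)
      (fun a ha ↦ hptw a (by rw [Set.uIcc_of_le hA.le] at ha; exact ha.1)),
      intervalIntegral_integral_fejer_swap hM hA.le, ← integral_const_mul]
    refine integral_congr_ae (Eventually.of_forall fun t ↦ ?_)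
    exact (average_fejer_eq hA t).symm
  exact (tendsto_integral_average_fejer hM).congr' hev

/-- **The cross-window law for `ζ`**: for every positive `μ` representing Weil's form on all tests with
`t⁻² ∈ L¹(μ)` and `a₁ > a₂ > 0`: `(a₁D(a₁) − a₂D(a₂))² ≤ (a₁+a₂)D(a₁+a₂) · (a₁−a₂)D(a₁−a₂)`. -/
theorem zeta_sq_sub_defect_le {μ : Measure ℝ}
    (hμ : ∀ g : ℝ → ℂ, IsWeilTest g →
      Integrable (fun t : ℝ ↦ ‖weilMellin g (1 / 2 + t * I)‖ ^ 2) μ ∧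
        weilQuadratic g = ((∫ t, ‖weilMellin g (1 / 2 + t * I)‖ ^ 2 ∂μ : ℝ) : ℂ))
    (hM : Integrable (fun t : ℝ ↦ (t ^ 2)⁻¹) μ) {a₁ a₂ : ℝ} (ha₂ : 0 < a₂) (h12 : a₂ < a₁) :
    let D : ℝ → ℝ := fun a ↦ 16 * Real.sinh (a / 2) ^ 2 / a -
          (Real.log (4 * π) + Real.eulerMascheroniConstant +
            2 * ∫ t in Ioi (0 : ℝ), weilKillingDensityPar 0 t) +
          1 / a * (∫ t in Ioi (0 : ℝ), weilArchDensityPar 0 t * min t (2 * a)) -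
          2 * (∑ n ∈ weilPrimeIndex a, (Λ n : ℝ) / Real.sqrt n * (1 - Real.log n / (2 * a))) -
          2 * a * μ.real {0}
    (a₁ * D a₁ - a₂ * D a₂) ^ 2 ≤ ((a₁ + a₂) * D (a₁ + a₂)) * ((a₁ - a₂) * D (a₁ - a₂)) := by
  intro D
  have ha₁ : 0 < a₁ := ha₂.trans h12
  have hE : ∀ a : ℝ, 0 < a → a * D a = ∫ t, 2 * Real.sin (a * t) ^ 2 / t ^ 2 ∂μ := by
    intro a ha
    obtain ⟨hF, heq⟩ := zetaFlatWindow_defect_eq ha (fun g hg _ ↦ hμ g hg)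
    show a * (16 * Real.sinh (a / 2) ^ 2 / a -
          (Real.log (4 * π) + Real.eulerMascheroniConstant +
            2 * ∫ t in Ioi (0 : ℝ), weilKillingDensityPar 0 t) +
          1 / a * (∫ t in Ioi (0 : ℝ), weilArchDensityPar 0 t * min t (2 * a)) -
          2 * (∑ n ∈ weilPrimeIndex a, (Λ n : ℝ) / Real.sqrt n * (1 - Real.log n / (2 * a))) -
          2 * a * μ.real {0}) = _
    rw [heq, ← integral_const_mul]
    refine integral_congr_ae (Eventually.of_forall fun t ↦ ?_)
    show a * (2 * Real.sin (a * t) ^ 2 / (a * t ^ 2)) = 2 * Real.sin (a * t) ^ 2 / t ^ 2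
    rcases eq_or_ne t 0 with rfl | ht
    · simp
    · field_simp
  rw [hE a₁ ha₁, hE a₂ ha₂, hE (a₁ + a₂) (by linarith), hE (a₁ - a₂) (by linarith)]
  exact sq_sub_fejerEnergy_le hM a₁ a₂

end Summit.Ventures.WeilGRH

end
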